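import Mathlib
import Summits.AnomalousDissipation.AnomalousDissipation.Theorems.LimitingAbsorptionFloorUpgradeStubPowerIdentityA
import HarnessLib

/-!
# The power identity for a lag kernel under a generalized limit (stub F4)

Crux `LimitingAbsorption.FloorUpgrade` (stmt-AnomalousDissipation-15010), line `SketchIdeator1`,
stub `stub_powerIdentity`. PURE TIME-AVERAGE ANALYSIS, no PDE. `K τ t` is a jointly continuous
lag kernel (lag `τ ≥ 0` observed from base/release time `t ≥ 0`) with `|K τ t| ≤ B e^{-βτ}` and
Cesàro-Lipschitz dependence on the lag (`|T⁻¹∫₀ᵀ K(τ', ·) - T⁻¹∫₀ᵀ K(τ, ·)| ≤ W (τ' - τ)` for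
`0 ≤ τ ≤ τ' ≤ T`, `T ≥ T₀`); `p(t) = ∫₀ᵗ K(τ, t - τ) dτ` is the accumulated response (Duhamel) and
`C(τ) = Λ-avg_t K(τ, t)` the correlation function under a generalized (Banach) limit `Λ`.

CLAIM (`stub_powerIdentity`, in fact the equality `PowerIdentity.longTimeAvg_eq_integral_corr`):
`∫₀^∞ C(τ) dτ = Λ-avg p`. A Banach limit does not commute with `∫ dτ` in general; the
Cesàro-Lipschitz hypothesis reduces the lag integral to FINITE sums uniformly in the horizon:

1. (part A, `PowerIdentity.abs_timeMean_sub_sum_le`) Fubini on the triangle and truncation /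
   discretisation of the lag:
   `|T⁻¹∫₀ᵀ p - ∑_{k<N} η T⁻¹∫₀ᵀ K(kη, ·)| ≤ τ₀|W|η + T⁻¹Bτ₀² + (B/β)e^{-βτ₀}`
   for `η = τ₀/N` and `T ≥ max(T₀, τ₀)`;
2. (`PowerIdentity.abs_longTimeAvg_sub_sum_le`) apply `Λ`: linear on the finite sum, and
   `|Λ g| ≤ c` whenever eventually `|g| ≤ c`, so
   `|Λ-avg p - ∑_{k<N} η C(kη)| ≤ τ₀|W|η + (B/β)e^{-βτ₀}`;
3. (`PowerIdentity.abs_integral_corr_sub_sum_le`) `C` is `W`-Lipschitz and `≤ B e^{-βτ}` on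
   `[0, ∞)` (`PowerIdentity.abs_corr_sub_corr_le_of_le`; cf. the correlation package F3), so
   `|∫₀^∞ C - ∑_{k<N} η C(kη)| ≤ τ₀|W|η + (B/β)e^{-βτ₀}`;
4. let `N → ∞`, then `τ₀ → ∞`.
-/

set_option linter.dupNamespace false

noncomputable section

open MeasureTheory Set Filter Topology
open scoped BigOperators

namespace Summit.AnomalousDissipation.AnomalousDissipation.Theorems.FloorUpgradeLine

namespace PowerIdentity

open Literature.Analysis.FluidPDE

variable (Λ : GeneralizedLimit) {K : ℝ → ℝ → ℝ} {p : ℝ → ℝ} {B β W T₀ : ℝ}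

/-! ### The correlation function on `[0, ∞)` -/

/-- **One-sided Lipschitz bound** for the correlation function `C(τ) = Λ-avg K(τ, ·)` on `[0, ∞)`:
`|C τ' - C τ| ≤ W (τ' - τ)` for `0 ≤ τ ≤ τ'`. The Cesàro means differ by at most `W (τ' - τ)` for
`T ≥ max T₀ τ'`, and `Λ` of the difference obeys the same bound (`|Λ g| ≤ c` if eventually
`|g| ≤ c`). [folklore] -/
theorem abs_corr_sub_corr_le_of_le (hlip : ∀ T, T₀ ≤ T → ∀ τ τ', 0 ≤ τ → τ ≤ τ' → τ' ≤ T →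
      |timeMean (K τ') T - timeMean (K τ) T| ≤ W * (τ' - τ)) {τ τ' : ℝ} (hτ : 0 ≤ τ)
    (hττ' : τ ≤ τ') : |Λ.longTimeAvg (K τ') - Λ.longTimeAvg (K τ)| ≤ W * (τ' - τ) := by
  unfold GeneralizedLimit.longTimeAvg
  rw [← map_sub]
  refine Λ.abs_apply_le ?_
  filter_upwards [eventually_ge_atTop T₀, eventually_ge_atTop τ'] with T hT hTτ'
  exact hlip T hT τ τ' hτ hττ' hTτ'

/-- **Continuity** of the clamped correlation function `τ ↦ C(max τ 0)`: it is `|W|`-Lipschitz on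
`ℝ` (`abs_corr_sub_corr_le_of_le` and `|max x 0 - max y 0| ≤ |x - y|`). [folklore] -/
theorem continuous_corr_max (hlip : ∀ T, T₀ ≤ T → ∀ τ τ', 0 ≤ τ → τ ≤ τ' → τ' ≤ T →
      |timeMean (K τ') T - timeMean (K τ) T| ≤ W * (τ' - τ)) :
    Continuous (fun τ => Λ.longTimeAvg (K (max τ 0))) := by
  have key : ∀ a b : ℝ, max a 0 ≤ max b 0 →
      |Λ.longTimeAvg (K (max b 0)) - Λ.longTimeAvg (K (max a 0))| ≤ |W| * |a - b| := by
    intro a b hab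
    calc |Λ.longTimeAvg (K (max b 0)) - Λ.longTimeAvg (K (max a 0))| ≤ W * (max b 0 - max a 0) :=
          abs_corr_sub_corr_le_of_le Λ hlip (le_max_right _ _) hab
      _ ≤ |W| * (max b 0 - max a 0) :=
          mul_le_mul_of_nonneg_right (le_abs_self W) (sub_nonneg.2 hab)
      _ ≤ |W| * |a - b| := by
          refine mul_le_mul_of_nonneg_left ?_ (abs_nonneg W)
          calc max b 0 - max a 0 ≤ |max b 0 - max a 0| := le_abs_self _
            _ ≤ |b - a| := abs_max_sub_max_le_abs _ _ _
            _ = |a - b| := abs_sub_comm _ _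
  refine (LipschitzWith.of_dist_le' (K := |W|) fun x y => ?_).continuous
  rw [Real.dist_eq, Real.dist_eq]
  rcases le_total (max x 0) (max y 0) with h | h
  · rw [abs_sub_comm]
    exact key x y h
  · simpa only [abs_sub_comm y x] using key y x h

/-! ### The three steps -/

/-- **Step 3 (apply `Λ`).** For every truncation lag `τ₀ > 0` and mesh `η = τ₀/N`,
`|Λ-avg p - ∑_{k<N} η C(kη)| ≤ τ₀ |W| η + (B/β) e^{-βτ₀}`, where `C(τ) = Λ-avg K(τ, ·)`: the
finite linear combination of Cesàro means passes through the linear functional `Λ`, and the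
remainder of `abs_timeMean_sub_sum_le` is eventually `≤ τ₀ |W| η + (B/β) e^{-βτ₀} + ε` for every
`ε > 0`, so `|Λ(remainder)|` obeys the same bound (`|Λ g| ≤ c` if eventually `|g| ≤ c`).
[folklore] -/
theorem abs_longTimeAvg_sub_sum_le (hβ : 0 < β) (hcont : Continuous (Function.uncurry K))
    (hbd : ∀ τ t, 0 ≤ τ → 0 ≤ t → |K τ t| ≤ B * Real.exp (-(β * τ)))
    (hlip : ∀ T, T₀ ≤ T → ∀ τ τ', 0 ≤ τ → τ ≤ τ' → τ' ≤ T →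
      |timeMean (K τ') T - timeMean (K τ) T| ≤ W * (τ' - τ))
    (hp : ∀ t, 0 ≤ t → p t = ∫ τ in (0 : ℝ)..t, K τ (t - τ))
    {τ₀ : ℝ} (hτ₀ : 0 < τ₀) {N : ℕ} (hN : 0 < N) :
    |Λ.longTimeAvg p - ∑ k ∈ Finset.range N, τ₀ / N * Λ.longTimeAvg (K (k * (τ₀ / N)))| ≤
      τ₀ * |W| * (τ₀ / N) + B / β * Real.exp (-(β * τ₀)) := by
  set η := τ₀ / N with hη
  -- the finite linear combination of Cesàro means, as a function of the horizon
  set S : ℝ → ℝ := ∑ k ∈ Finset.range N, η • timeMean (K (k * η)) with hS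
  have hΛS : Λ S = ∑ k ∈ Finset.range N, η * Λ.longTimeAvg (K (k * η)) := by
    rw [hS, map_sum]
    refine Finset.sum_congr rfl fun k _ => ?_
    rw [map_smul, smul_eq_mul]
    rfl
  have hSapp : ∀ T, S T = ∑ k ∈ Finset.range N, η * timeMean (K (k * η)) T := by
    intro T
    simp only [hS, Finset.sum_apply, Pi.smul_apply, smul_eq_mul]
  have hdec : Λ.longTimeAvg p = Λ S + Λ (timeMean p - S) := by
    rw [← map_add, add_sub_cancel]
    rfl
  rw [hdec, hΛS, add_sub_cancel_left]
  refine le_of_forall_pos_le_add fun ε hε => ?_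
  refine Λ.abs_apply_le ?_
  have hB : 0 ≤ B := nonneg_of_bound hbd
  filter_upwards [eventually_gt_atTop 0, eventually_ge_atTop T₀, eventually_ge_atTop τ₀,
    eventually_ge_atTop (B * τ₀ ^ 2 / ε)] with T hT hT₀ hτ₀T hTε
  rw [Pi.sub_apply, hSapp]
  have hrem : T⁻¹ * B * τ₀ ^ 2 ≤ ε := by
    have h1 : B * τ₀ ^ 2 ≤ T * ε := (div_le_iff₀ hε).1 hTε
    rw [show T⁻¹ * B * τ₀ ^ 2 = B * τ₀ ^ 2 / T by ring, div_le_iff₀ hT]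
    linarith [mul_comm T ε]
  calc |timeMean p T - ∑ k ∈ Finset.range N, η * timeMean (K (k * η)) T|
      ≤ τ₀ * |W| * η + T⁻¹ * B * τ₀ ^ 2 + B / β * Real.exp (-(β * τ₀)) :=
        abs_timeMean_sub_sum_le hβ hcont hbd hlip hp hτ₀ hN hT hT₀ hτ₀T
    _ ≤ τ₀ * |W| * η + B / β * Real.exp (-(β * τ₀)) + ε := by linarith

/-- **Step 4 (the zero-frequency integral).** For every `τ₀ > 0` and mesh `η = τ₀/N`,
`|∫₀^∞ C - ∑_{k<N} η C(kη)| ≤ τ₀ |W| η + (B/β) e^{-βτ₀}`: the clamped extension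
`τ ↦ Λ-avg K(max τ 0, ·)` of `C` is continuous (`|W|`-Lipschitz) and bounded by `B e^{-βτ}` on
`[0, ∞)`, hence integrable on `(0, ∞)` with tail `≤ (B/β) e^{-βτ₀}` beyond `τ₀` and left Riemann
sums on `[0, τ₀]` accurate to `τ₀ |W| η`. [folklore] -/
theorem abs_integral_corr_sub_sum_le (hβ : 0 < β)
    (hbd : ∀ τ t, 0 ≤ τ → 0 ≤ t → |K τ t| ≤ B * Real.exp (-(β * τ)))
    (hlip : ∀ T, T₀ ≤ T → ∀ τ τ', 0 ≤ τ → τ ≤ τ' → τ' ≤ T →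
      |timeMean (K τ') T - timeMean (K τ) T| ≤ W * (τ' - τ))
    {τ₀ : ℝ} (hτ₀ : 0 < τ₀) {N : ℕ} (hN : 0 < N) :
    |(∫ τ in Ioi (0 : ℝ), Λ.longTimeAvg (K τ)) -
        ∑ k ∈ Finset.range N, τ₀ / N * Λ.longTimeAvg (K (k * (τ₀ / N)))| ≤
      τ₀ * |W| * (τ₀ / N) + B / β * Real.exp (-(β * τ₀)) := by
  set η := τ₀ / N with hη
  have hNpos : (0 : ℝ) < N := Nat.cast_pos.2 hN
  have hη0 : 0 < η := div_pos hτ₀ hNpos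
  have hNη : (N : ℝ) * η = τ₀ := by rw [hη]; field_simp
  -- the clamped (continuous) extension of the correlation function
  set Ce : ℝ → ℝ := fun τ => Λ.longTimeAvg (K (max τ 0)) with hCe
  have hCe_cont : Continuous Ce := continuous_corr_max Λ hlip
  have hCe_eq : ∀ τ, 0 ≤ τ → Ce τ = Λ.longTimeAvg (K τ) := fun τ hτ => by
    simp only [hCe, max_eq_left hτ]
  have hCe_bd : ∀ τ, 0 ≤ τ → |Ce τ| ≤ B * Real.exp (-(β * τ)) := fun τ hτ => by
    rw [hCe_eq τ hτ]
    exact Λ.abs_longTimeAvg_le fun t ht => hbd τ t hτ ht.le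
  -- `C = Ce` on `(0, ∞)`
  have hC : ∫ τ in Ioi (0 : ℝ), Λ.longTimeAvg (K τ) = ∫ τ in Ioi (0 : ℝ), Ce τ :=
    setIntegral_congr_fun measurableSet_Ioi fun τ hτ => (hCe_eq τ (le_of_lt hτ)).symm
  -- integrability on half-lines
  have hint : ∀ a, 0 ≤ a → IntegrableOn Ce (Ioi a) := by
    intro a ha
    refine Integrable.mono' (integrableOn_Ioi_const_mul_exp_neg hβ B a)
      hCe_cont.aestronglyMeasurable ?_
    filter_upwards [ae_restrict_mem measurableSet_Ioi] with τ hτ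
    rw [Real.norm_eq_abs]
    exact hCe_bd τ (ha.trans (le_of_lt hτ))
  have hsplit : ∫ τ in Ioi (0 : ℝ), Ce τ = (∫ τ in (0 : ℝ)..τ₀, Ce τ) + ∫ τ in Ioi τ₀, Ce τ :=
    (intervalIntegral.integral_interval_add_Ioi (hint 0 le_rfl) (hint τ₀ hτ₀.le)).symm
  -- the tail beyond `τ₀`
  have hTail : |∫ τ in Ioi τ₀, Ce τ| ≤ B / β * Real.exp (-(β * τ₀)) := by
    have h := norm_integral_le_of_norm_le (μ := volume.restrict (Ioi τ₀)) (f := Ce)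
      (integrableOn_Ioi_const_mul_exp_neg hβ B τ₀) ?_
    · rwa [Real.norm_eq_abs, integral_Ioi_const_mul_exp_neg hβ] at h
    · filter_upwards [ae_restrict_mem measurableSet_Ioi] with τ hτ
      rw [Real.norm_eq_abs]
      exact hCe_bd τ (hτ₀.le.trans (le_of_lt hτ))
  -- the left Riemann sum on `[0, τ₀]`
  have hosc : ∀ k : ℕ, k < N → ∀ τ, (k : ℝ) * η ≤ τ → τ ≤ ((k : ℝ) + 1) * η →
      |Ce τ - Ce (k * η)| ≤ |W| * η := by
    intro k _ τ hkτ hτk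
    have hk0 : 0 ≤ (k : ℝ) * η := mul_nonneg (Nat.cast_nonneg k) hη0.le
    have hk1 : ((k : ℝ) + 1) * η = k * η + η := by ring
    rw [hCe_eq τ (hk0.trans hkτ), hCe_eq _ hk0]
    calc |Λ.longTimeAvg (K τ) - Λ.longTimeAvg (K (k * η))| ≤ W * (τ - k * η) :=
          abs_corr_sub_corr_le_of_le Λ hlip hk0 hkτ
      _ ≤ |W| * (τ - k * η) := mul_le_mul_of_nonneg_right (le_abs_self W) (sub_nonneg.2 hkτ)
      _ ≤ |W| * η := mul_le_mul_of_nonneg_left (by linarith) (abs_nonneg W)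
  have hR := abs_integral_sub_riemannSum_le hη0.le
    (fun a b => hCe_cont.intervalIntegrable a b) N hosc
  rw [hNη] at hR
  have hsum : ∑ k ∈ Finset.range N, η * Ce (k * η) =
      ∑ k ∈ Finset.range N, η * Λ.longTimeAvg (K (k * η)) := by
    refine Finset.sum_congr rfl fun k _ => ?_
    rw [hCe_eq _ (mul_nonneg (Nat.cast_nonneg k) hη0.le)]
  rw [hsum] at hR
  rw [hC, hsplit]
  calc |(∫ τ in (0 : ℝ)..τ₀, Ce τ) + (∫ τ in Ioi τ₀, Ce τ) -
        ∑ k ∈ Finset.range N, η * Λ.longTimeAvg (K (k * η))|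
      = |((∫ τ in (0 : ℝ)..τ₀, Ce τ) - ∑ k ∈ Finset.range N, η * Λ.longTimeAvg (K (k * η))) +
          ∫ τ in Ioi τ₀, Ce τ| := by ring_nf
    _ ≤ |(∫ τ in (0 : ℝ)..τ₀, Ce τ) - ∑ k ∈ Finset.range N, η * Λ.longTimeAvg (K (k * η))| +
          |∫ τ in Ioi τ₀, Ce τ| := abs_add_le _ _
    _ ≤ τ₀ * (|W| * η) + B / β * Real.exp (-(β * τ₀)) := add_le_add hR hTail
    _ = τ₀ * |W| * η + B / β * Real.exp (-(β * τ₀)) := by ring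

/-- **The power identity (Green–Kubo / Duhamel in the mean), two-sided form.** For a jointly
continuous lag kernel with `|K τ t| ≤ B e^{-βτ}` and Cesàro-Lipschitz dependence on the lag, the
accumulated response `p(t) = ∫₀ᵗ K(τ, t - τ) dτ` has generalized mean equal to the zero-frequency
integral of the correlation function: `Λ-avg p = ∫₀^∞ Λ-avg_t K(τ, t) dτ`. Steps 3 and 4 give
`|Λ-avg p - ∫₀^∞ C| ≤ 2 τ₀ |W| τ₀/N + 2 (B/β) e^{-βτ₀}` for all `τ₀ > 0`, `N ≥ 1`. [folklore] -/
theorem longTimeAvg_eq_integral_corr (hβ : 0 < β) (hcont : Continuous (Function.uncurry K))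
    (hbd : ∀ τ t, 0 ≤ τ → 0 ≤ t → |K τ t| ≤ B * Real.exp (-(β * τ)))
    (hlip : ∀ T, T₀ ≤ T → ∀ τ τ', 0 ≤ τ → τ ≤ τ' → τ' ≤ T →
      |timeMean (K τ') T - timeMean (K τ) T| ≤ W * (τ' - τ))
    (hp : ∀ t, 0 ≤ t → p t = ∫ τ in (0 : ℝ)..t, K τ (t - τ)) :
    Λ.longTimeAvg p = ∫ τ in Ioi (0 : ℝ), Λ.longTimeAvg (K τ) := by
  have hB : 0 ≤ B := nonneg_of_bound hbd
  refine eq_of_forall_dist_le fun ε hε => ?_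
  rw [Real.dist_eq]
  -- choose the truncation lag `τ₀`
  have htend : Tendsto (fun τ₀ : ℝ => 2 * (B / β) * Real.exp (-(β * τ₀))) atTop (𝓝 0) := by
    have h1 : Tendsto (fun τ₀ : ℝ => Real.exp (-(β * τ₀))) atTop (𝓝 0) :=
      Real.tendsto_exp_neg_atTop_nhds_zero.comp (tendsto_id.const_mul_atTop hβ)
    simpa using h1.const_mul (2 * (B / β))
  obtain ⟨τ₀, hτ₀ε, hτ₀⟩ :=
    ((Tendsto.eventually_le_const (half_pos hε) htend).and (eventually_gt_atTop 0)).exists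
  -- choose the mesh `η = τ₀ / N`
  obtain ⟨N, hN⟩ := exists_nat_gt (4 * τ₀ ^ 2 * |W| / ε)
  have hNpos : (0 : ℝ) < N := lt_of_le_of_lt (by positivity) hN
  have hN0 : 0 < N := Nat.cast_pos.1 hNpos
  have hmesh : 2 * (τ₀ * |W| * (τ₀ / N)) ≤ ε / 2 := by
    have h1 : 4 * τ₀ ^ 2 * |W| < N * ε := (div_lt_iff₀ hε).1 hN
    have h3 : τ₀ ^ 2 * |W| / N ≤ ε / 4 := by
      rw [div_le_iff₀ hNpos]
      linarith
    calc 2 * (τ₀ * |W| * (τ₀ / N)) = 2 * (τ₀ ^ 2 * |W| / N) := by ring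
      _ ≤ 2 * (ε / 4) := by linarith
      _ = ε / 2 := by ring
  have h1 := abs_longTimeAvg_sub_sum_le Λ hβ hcont hbd hlip hp hτ₀ hN0
  have h2 := abs_integral_corr_sub_sum_le Λ hβ hbd hlip hτ₀ hN0
  calc |Λ.longTimeAvg p - ∫ τ in Ioi (0 : ℝ), Λ.longTimeAvg (K τ)|
      ≤ |Λ.longTimeAvg p - ∑ k ∈ Finset.range N, τ₀ / N * Λ.longTimeAvg (K (k * (τ₀ / N)))| +
        |(∫ τ in Ioi (0 : ℝ), Λ.longTimeAvg (K τ)) -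
          ∑ k ∈ Finset.range N, τ₀ / N * Λ.longTimeAvg (K (k * (τ₀ / N)))| := by
        rw [abs_sub_comm (∫ τ in Ioi (0 : ℝ), Λ.longTimeAvg (K τ))]
        exact abs_sub_le _ _ _
    _ ≤ 2 * (τ₀ * |W| * (τ₀ / N)) + 2 * (B / β) * Real.exp (-(β * τ₀)) := by linarith
    _ ≤ ε / 2 + ε / 2 := add_le_add hmesh hτ₀ε
    _ = ε := by ring

end PowerIdentity

/-- **F4: the power identity (Green–Kubo / Duhamel in the mean).** Pure time-average analysis.
For a jointly continuous lag kernel with `|K τ t| ≤ B e^{-βτ}` and Cesàro-equicontinuity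
(Cesàro-Lipschitz dependence) in the lag, the accumulated response `p(t) = ∫₀ᵗ K(τ, t - τ) dτ`
(Duhamel: input power of the cold start = integral of the release kernel over past release
times) has generalized mean at least — in fact exactly
(`PowerIdentity.longTimeAvg_eq_integral_corr`) — the zero-frequency integral of the correlation
function: `∫₀^∞ Λ-avg_t K(τ, t) dτ ≤ Λ-avg p`. Proof: Fubini on the triangle, tail truncation at
`τ₀` (cost `(B/β) e^{-βτ₀}`), left Riemann sums in the lag with the equicontinuity modulus,
linearity of `Λ` on finite sums and `|Λ f| ≤ c` for eventually `|f| ≤ c`. [folklore] -/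
theorem stub_powerIdentity (K : ℝ → ℝ → ℝ) (p : ℝ → ℝ) (B β W T₀ : ℝ)
    (Λ : Literature.Analysis.FluidPDE.GeneralizedLimit) (hβ : 0 < β)
    (hcont : Continuous (Function.uncurry K))
    (hbd : ∀ τ t, 0 ≤ τ → 0 ≤ t → |K τ t| ≤ B * Real.exp (-(β * τ)))
    (hlip : ∀ T, T₀ ≤ T → ∀ τ τ', 0 ≤ τ → τ ≤ τ' → τ' ≤ T →
      |Literature.Analysis.FluidPDE.timeMean (K τ') T -
        Literature.Analysis.FluidPDE.timeMean (K τ) T| ≤ W * (τ' - τ))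
    (hp : ∀ t, 0 ≤ t → p t = ∫ τ in (0 : ℝ)..t, K τ (t - τ)) :
    ∫ τ in Ioi (0 : ℝ), Λ.longTimeAvg (K τ) ≤ Λ.longTimeAvg p :=
  (PowerIdentity.longTimeAvg_eq_integral_corr Λ hβ hcont hbd hlip hp).symm.le

end Summit.AnomalousDissipation.AnomalousDissipation.Theorems.FloorUpgradeLine

end
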